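import Summits.FinalStateConjecture.FinalStateConjecture.Theses.StarvedNecks
import Literature.Geometry.Lorentzian.FutureNullCompleteness
import Literature.Geometry.Lorentzian.EventHorizonAreaProofs
import Literature.Geometry.Lorentzian.CausalFutureProofs

/-!
# Route StarvedNecks — crux `HonestFixedRadiusSettling`, line `sojourn-needs-only-one-over-delta`:
# stub `stub_entryBookkeeping` (causal membership from the exit event on + tube clearance of a cone)

The DEF-FREE form of `EntryBookkeeping` of the line skeleton (verbatim registered signature).
Setting: a vacuum Cauchy development `𝒟` of data on `X` (embedding `ι = 𝒟.embed`), an `N`-hole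
final-state decomposition `d` of `𝒟` with flat chart `Φ = d.flatChart : d.flatDomain → 𝒟`, an
inner radius profile `Rs` of slope `≤ 2` after time `0`, a core `Bs ⊆ X`, and `κ > 0`, subject
to three of the one-atlas-at-infinity clauses:

* INJECTIVE — `Φ` is injective on `{0 ≤ y⁰}`;
* COVER — `J⁺(ι X) ⊆ J⁺(ι Bs) ∪ Φ({0 ≤ y⁰ ∧ Rs(y⁰) < |y⃗|})`;
* SEPARATED — a flat point `z` with `τ₀ ≤ z⁰` inside the excision tube of hole `i`
  (`rᵢ(Λᵢ⁻¹(z − cᵢ)) ≤ ρᵢ(z⁰)`) satisfies `|z⃗| + κ z⁰ ≤ Rs(z⁰)`.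

A normalised null ray `γ` from `p ∈ X` (maximal geodesic on the open interval `dom ∋ 0`,
`γ 0 = ι p`, future null `γ' 0`) sits at parameter `s ≥ 0`, `s ∈ dom`, at the flat point
`γ s = Φ y` with `τ₀ < y⁰`, `0 ≤ y⁰`, ON the inner boundary `|y⃗| = Rs(y⁰)`. Conclusions:

1. (causal membership) `γ s' ∈ J⁺(ι Bs)` for every `s' ∈ dom`, `s' ≥ s`. Proof: the future null
   character of `γ'` propagates along the geodesic (`IsGeodesicOn.isNull_and_isFutureDirected_velocity`,
   O'Neill 1983, Ch. 3, p. 69 and Ch. 5, Lemma 5.26), so `γ|[0, s]` is a future causal curve and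
   `γ s ∈ J⁺(ι p) ⊆ J⁺(ι X)`; by COVER `γ s ∈ J⁺(ι Bs)` or `γ s = Φ y'` with `0 ≤ y'⁰`,
   `Rs(y'⁰) < |y⃗'|` — the latter is excluded by INJECTIVE (`y' = y`, but `|y⃗| = Rs(y⁰)`); then
   `γ s' ∈ J⁺(γ s) ⊆ J⁺(J⁺(ι Bs)) = J⁺(ι Bs)` (O'Neill 1983, Ch. 14, p. 402, the tree's
   `LorentzianMetric.causalFuture_causalFuture_eq`).
2. (tube clearance) if `(4T + 2)/κ ≤ y⁰` then the coordinate cone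
   `{y⁰ ≤ z⁰ ≤ y⁰ + T, ‖z⃗ − y⃗‖ ≤ 2(z⁰ − y⁰) + 1}` lies in `d.flatDomain`: a cone point inside
   tube `i` would give `κ z⁰ ≤ Rs(z⁰) − |z⃗| ≤ (Rs(y⁰) + 2(z⁰ − y⁰)) − (Rs(y⁰) − 2(z⁰ − y⁰) − 1)
   ≤ 4T + 1 < 4T + 2 ≤ κ y⁰ ≤ κ z⁰`; so every tube is cleared strictly and
   `d.setOf_lt_excision_subset_flatDomain` applies (`τ₀ < y⁰ ≤ z⁰`).

No definitions, no named facts; standard axioms.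

References: B. O'Neill, *Semi-Riemannian geometry*, Academic Press 1983, Ch. 3, p. 69; Ch. 5,
Lemma 5.26; Ch. 14, pp. 402–403. D. Christodoulou, CQG 16 (1999) A23, pp. A26–A27 (normalised
null rays). M. Dafermos, I. Rodnianski, arXiv:0811.0354, §2.6.2.
-/

noncomputable section

set_option linter.dupNamespace false

open Literature.Geometry.Lorentzian
open scoped Manifold ContDiff ENNReal Topology
open Filter Set MeasureTheory Topology

namespace Summit.FinalStateConjecture.FinalStateConjecture.Theorems.StarvedNecks.OneOverDelta

universe u

/-- **Points of a null ray are causally after its earlier points.** In a spacetime `𝓢` (Hausdorff,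
without boundary, smooth metric), let `γ` be a maximal geodesic of the Levi-Civita connection on
the open interval `dom ∋ 0` with future null velocity at `0`. Then for `a ≤ b` in `dom`,
`γ b ∈ J⁺(γ a)`: the velocity stays future null along `dom`
(`IsGeodesicOn.isNull_and_isFutureDirected_velocity`), so `γ|[a, b]` is a future causal curve.
O'Neill 1983, Ch. 3, p. 69; Ch. 5, Lemma 5.26; Ch. 14, p. 402. [folklore] -/
theorem nullRay_apply_mem_causalFuture {n : ℕ} (𝓢 : Spacetime.{u} n) [𝓢.metric.HasLeviCivita]
    {γ : ℝ → 𝓢.carrier} {dom : Set ℝ} (hγ : IsMaximalGeodesicOn 𝓢.metric.leviCivita γ dom)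
    (h0 : (0 : ℝ) ∈ dom) (hnull : 𝓢.metric.IsNull (velocity (𝓡 n) γ 0))
    (hfut : 𝓢.timeOrientation.IsFutureDirected (velocity (𝓡 n) γ 0))
    {a b : ℝ} (ha : a ∈ dom) (hb : b ∈ dom) (hab : a ≤ b) :
    γ b ∈ 𝓢.metric.causalFuture 𝓢.timeOrientation {γ a} := by
  haveI : CovariantDerivative.ContMDiffCovariantDerivative 𝓢.metric.leviCivita 1 :=
    Spacetime.contMDiffCovariantDerivative_leviCivita_one
  have hfd : ∀ t ∈ dom, 𝓢.timeOrientation.IsFutureDirected (velocity (𝓡 n) γ t) := fun t ht ↦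
    (hγ.isGeodesicOn.isNull_and_isFutureDirected_velocity 𝓢.metric 𝓢.timeOrientation hγ.isOpen
      hγ.2.1 h0 hnull hfut ht).2
  have hcurve : 𝓢.metric.IsFutureCausalCurveOn 𝓢.timeOrientation γ (Icc a b) := fun t ht ↦
    ⟨IsGeodesicOn.mdifferentiableAt_holds hγ.isGeodesicOn (hγ.2.1.out ha hb ht),
      hfd t (hγ.2.1.out ha hb ht)⟩
  rcases eq_or_lt_of_le hab with h | h
  · subst h
    exact LorentzianMetric.subset_causalFuture _ _ _ (mem_singleton _)
  · exact Or.inr ⟨γ a, mem_singleton _, γ, a, b, h, hcurve, rfl, rfl⟩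

/-- **Tube clearance of a coordinate cone** (pure real-inequality bookkeeping). For a final-state
decomposition `d` with SEPARATED excision tubes (`|z⃗| + κ z⁰ ≤ Rs(z⁰)` inside a tube, from `τ₀`
on), a radius profile `Rs` of slope `≤ 2` after time `0`, and a flat point `y` with `τ₀ < y⁰`,
`0 ≤ y⁰`, `|y⃗| = Rs(y⁰)` and `(4T + 2)/κ ≤ y⁰`, the cone `{y⁰ ≤ z⁰ ≤ y⁰ + T,
‖z⃗ − y⃗‖ ≤ 2(z⁰ − y⁰) + 1}` misses every tube strictly, hence lies in `d.flatDomain`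
(`setOf_lt_excision_subset_flatDomain`). [folklore] -/
theorem coordCone_subset_flatDomain {𝓢 : Spacetime.{u} 4} {O : Set 𝓢.carrier} {k : ℕ}
    (d : FinalStateDecomposition 𝓢 O k) {Rs : ℝ → ℝ} {κ T : ℝ} {y : E4} (hκ : 0 < κ)
    (hslope : ∀ t t' : ℝ, 0 ≤ t → t ≤ t' → Rs t' ≤ Rs t + 2 * (t' - t))
    (hsep : ∀ (i : Fin d.N) (z : E4), d.τ₀ ≤ z 0 →
      Kerr.radius (d.spin i) (poincareInv (d.motion i).1 (d.motion i).2 z) ≤ d.excision i (z 0) →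
        E4.spatialNorm z + κ * z 0 ≤ Rs (z 0))
    (hτ : d.τ₀ < y 0) (hy0 : 0 ≤ y 0) (hR : E4.spatialNorm y = Rs (y 0))
    (hbig : (4 * T + 2) / κ ≤ y 0) :
    {z : E4 | y 0 ≤ z 0 ∧ z 0 ≤ y 0 + T ∧ ‖E4.spatial z - E4.spatial y‖ ≤ 2 * (z 0 - y 0) + 1} ⊆
      (d.flatDomain : Set E4) := by
  intro z hz
  obtain ⟨hz1, hz2, hz3⟩ := hz
  apply d.setOf_lt_excision_subset_flatDomain
  refine ⟨hτ.trans_le hz1, fun i ↦ ?_⟩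
  by_contra hcon
  have h1 := hsep i z (hτ.le.trans hz1) (not_lt.mp hcon)
  have h2 := hslope (y 0) (z 0) hy0 hz1
  have h3 : E4.spatialNorm y - E4.spatialNorm z ≤ ‖E4.spatial z - E4.spatial y‖ := by
    unfold E4.spatialNorm
    rw [← norm_sub_rev (E4.spatial y) (E4.spatial z)]
    exact norm_sub_norm_le _ _
  have h4 : 4 * T + 2 ≤ κ * y 0 := by
    rw [div_le_iff₀ hκ] at hbig
    linarith [mul_comm (y 0) κ]
  have h5 : κ * y 0 ≤ κ * z 0 := mul_le_mul_of_nonneg_left hz1 hκ.le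
  linarith

/-- **Stub `stub_entryBookkeeping`** (DEF-FREE form of `EntryBookkeeping` of line
`sojourn-needs-only-one-over-delta`; verbatim registered signature). Hypotheses: the one-atlas
clauses `κ > 0`, slope `≤ 2`, INJECTIVE, COVER, SEPARATED, and the exit-event clauses `s ∈ dom`,
`0 ≤ s`, `γ s = Φ y`, `τ₀ < y⁰`, `0 ≤ y⁰`, `|y⃗| = Rs(y⁰)`. Conclusions: (i) from `s` on the ray is
in `J⁺(ι '' Bs)` (null geodesic ⇒ future causal curve, `γ s ∈ J⁺(ι X)`, COVER, INJECTIVE excludes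
the flat-zone alternative on the inner boundary, transitivity `J⁺ ∘ J⁺ = J⁺`); (ii) for
`(4T + 2)/κ ≤ y⁰` the coordinate cone of height `T` over `y` lies in `flatDomain`
(`coordCone_subset_flatDomain`). O'Neill 1983, Ch. 14, pp. 402–403; Christodoulou, CQG 16 (1999)
A23, p. A26. [folklore] -/
theorem stub_entryBookkeeping :
    ∀ (X : Type) [TopologicalSpace X] [ChartedSpace E3 X] [IsManifold (𝓡 3) ∞ X] [T2Space X]
      [SecondCountableTopology X] [ConnectedSpace X] (D : InitialDataSet (𝓡 3) X)
      (𝒟 : VacuumCauchyDevelopment D) (O : Set 𝒟.carrier) (k : ℕ) (d : FinalStateDecomposition 𝒟.toSpacetime O k)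
      (Rs : ℝ → ℝ) (Bs : Set X) (κ : ℝ),
      0 < κ →
      (∀ t t' : ℝ, 0 ≤ t → t ≤ t' → Rs t' ≤ Rs t + 2 * (t' - t)) →
      Set.InjOn d.flatChart {y : d.flatDomain | 0 ≤ y.1 0} →
      (𝒟.metric.causalFuture 𝒟.timeOrientation (range 𝒟.embed) ⊆
        𝒟.metric.causalFuture 𝒟.timeOrientation (𝒟.embed '' Bs) ∪
          d.flatChart '' {y : d.flatDomain | 0 ≤ y.1 0 ∧ Rs (y.1 0) < E4.spatialNorm y.1}) →
      (∀ (i : Fin d.N) (z : E4), d.τ₀ ≤ z 0 →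
        Kerr.radius (d.spin i) (poincareInv (d.motion i).1 (d.motion i).2 z) ≤ d.excision i (z 0) →
          E4.spatialNorm z + κ * z 0 ≤ Rs (z 0)) →
      ∀ [𝒟.metric.HasLeviCivita] (p : X) (γ : ℝ → 𝒟.carrier) (dom : Set ℝ),
        𝒟.metric.IsNormalisedNullRayFrom 𝒟.timeOrientation 𝒟.embed 𝒟.normal p γ dom →
        ∀ (T s : ℝ) (y : d.flatDomain),
          s ∈ dom → 0 ≤ s → γ s = d.flatChart y → d.τ₀ < y.1 0 → 0 ≤ y.1 0 →
          E4.spatialNorm y.1 = Rs (y.1 0) → 0 ≤ T →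
          (∀ s' ∈ dom, s ≤ s' → γ s' ∈ 𝒟.metric.causalFuture 𝒟.timeOrientation (𝒟.embed '' Bs)) ∧
          ((4 * T + 2) / κ ≤ y.1 0 →
            {z : E4 | y.1 0 ≤ z 0 ∧ z 0 ≤ y.1 0 + T ∧ ‖E4.spatial z - E4.spatial y.1‖ ≤ 2 * (z 0 - y.1 0) + 1} ⊆
              (d.flatDomain : Set E4)) := by
  intro X _ _ _ _ _ _ D 𝒟 O k d Rs Bs κ hκ hslope hinj hcover hsep _ p γ dom hray T s y hs hs0 hγs
    hτ hy0 hR _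
  -- the exit point is in `J⁺(ι Bs)`
  have hJs : γ s ∈ 𝒟.metric.causalFuture 𝒟.timeOrientation (𝒟.embed '' Bs) := by
    have h1 : γ s ∈ 𝒟.metric.causalFuture 𝒟.timeOrientation (range 𝒟.embed) := by
      have h := nullRay_apply_mem_causalFuture 𝒟.toSpacetime hray.1 hray.2.1 hray.2.2.2.1
        hray.2.2.2.2.1 hray.2.1 hs hs0
      rw [hray.2.2.1] at h
      exact LorentzianMetric.causalFuture_mono (singleton_subset_iff.2 (mem_range_self p)) h
    rcases hcover h1 with h | ⟨y', hy', hyy'⟩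
    · exact h
    · exfalso
      have hy'y : y' = y := hinj hy'.1 hy0 (hyy'.trans hγs)
      rw [hy'y] at hy'
      exact (lt_irrefl _) (hR ▸ hy'.2)
  refine ⟨fun s' hs' hss' ↦ ?_, fun hbig ↦ ?_⟩
  · have h2 := nullRay_apply_mem_causalFuture 𝒟.toSpacetime hray.1 hray.2.1 hray.2.2.2.1
      hray.2.2.2.2.1 hs hs' hss'
    have h3 : γ s' ∈ 𝒟.metric.causalFuture 𝒟.timeOrientation
        (𝒟.metric.causalFuture 𝒟.timeOrientation (𝒟.embed '' Bs)) :=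
      LorentzianMetric.causalFuture_mono (singleton_subset_iff.2 hJs) h2
    rwa [LorentzianMetric.causalFuture_causalFuture_eq (WithTop.coe_le_coe.mpr le_top)] at h3
  · exact coordCone_subset_flatDomain d hκ hslope hsep hτ hy0 hR hbig

end Summit.FinalStateConjecture.FinalStateConjecture.Theorems.StarvedNecks.OneOverDelta

end
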